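/- Width seat `ym-line-sfw-p2-w5` (prover-ym-line-sfw-p2-w5-g19-0), free hands on planner ym-idea-2 g17's typed task T-U2.S
(`Cruxes/BoxWindowHighSU2213/TaskU2S.lean`, STUB-PLAN-U2 rev 2 §3) for LINE-20 «landau-rung3» stub U2 on ⟨stmt-QuantumFields-24336⟩. -/
import Summits.QuantumFields.YangMills.Theorems.AllWindowsColdBoxBoxHighLineUniformGaugeDefs
import Summits.QuantumFields.YangMills.Theorems.AllWindowsColdBoxBoxHighLineLandauMinimiser

/-!
# T-U2.S («uniformised temporal gauge»), part 3a: the links of the forest gauge and of the uniformised configuration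

The sharp Stage I of LINE-20 U2 (planner ym-idea-2 g17, STUB-PLAN-U2 rev 2 §3.2–3.3): on `ColdWall H U ∧ SmallPlaquettes H s U` with `s·H² ≤ 1/16` the
interior gauge transform `uniformGauge H U = spreadGauge · forestGauge` puts EVERY box link within quaternion distance `150·H·s` of `1`
(`ellq_uniform_link_le`), hence `uniformGaugeBound : UniformGaugeBound` (`C = 150`, `c = 1/16`) and, summing over `#boxEdges ≤ 4(2H+1)⁴ ≤ 324 H⁴` links,
`sharpStageI : SharpStageI` (`C = 7290000`, `c = 1/16`).  The forest links are read off the tree's abstract Poincaré ladder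
(`WeakCouplingRates.ell_spatial`, `ell_spatial_bottom`, `ell_temporal_face`, `ell_le_uniform`) instantiated with the quaternion length `ellq` (part 1);
the column holonomies `h_y = forestFix H U ((0,y),e₀)` (the only `H²·s` links) are spread over their columns by `k_y^{2H−x₀}`, `k_y = kroot (2H) h_y`
(`temporal_link_eq`: every temporal link of an interior column becomes `k_y`, `‖q(k_y) − 1‖ ≤ (π/2)·15H²s/(2H)`); spatial links between interior columns
move by `‖q(k_y^t) − q(k_{y'}^t)‖ ≤ t·18·‖q(h_y) − q(h_{y'})‖/(2H) ≤ 18·8Hs` (root Lipschitz, part 1; neighbouring column holonomies differ by `≤ 8Hs`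
through the bottom plaquette, `norm_colHol_sub_le`), and next to a side face by `t·‖q(k_y) − 1‖ ≤ (π/2)·‖q(h_y) − 1‖ ≤ 2·(8H+1)s` (face columns are skin).

This module (3a): §1 the column projection `col`, §2 the gauge transforms (`uniformGauge_isInteriorGauge`), §3 the forest-gauge links in the quaternion
length (`ellq_hol_le`, `ellq_forestFix_le`, `ellq_forestFix_spatial_le`, `ellq_forestFix_temporal_face_le`, `norm_colHol_sub_le`), §4 `temporal_link_eq`;
the per-link bound and the two Props are in part 3b `…UniformTemporalGauge`.  Everything proved, Mathlib + tree only; no definition, no sorry; standard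
axioms.  HONEST LABEL: the typed task T-U2.S (a free-standing INPUT of the
bootstrap re-run for the OPEN stub U2 `stub_landauRepresentativeStrong : LandauRepresentativeBound`) of a critic-PASSed DRAFT-by-design line on the R2ξ″
RECORD-rung crux ⟨24336⟩; no stub is proved by name, no crux, rung or summit is proved; the Yang–Mills mass gap is NOT proved by this file.
-/

set_option autoImplicit false

noncomputable section

open scoped Real Quaternion
open Literature.MathematicalPhysics.QuantumFieldTheory hiding boxEdges
open Literature.MathematicalPhysics.QuantumFieldTheory.LatticeMaxwell
open Literature.MathematicalPhysics.QuantumFieldTheory.AxialGauge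
open Summit.QuantumFields.YangMills.Theorems.WeakCouplingRates
open Literature.Probability.LatticeModels (Site)
open Literature.MathematicalPhysics.QuantumLattice
open Literature.MathematicalPhysics.QuantumFieldTheory.Balaban1983to89.T4HaarSU2Translate (su2Quat_mul su2Quat_one)

namespace Summit.QuantumFields.YangMills.Theorems.AllWindowsColdBoxBoxHighLine.UniformGauge

variable {H : ℕ}

/-! ## §1 The column projection -/

/-- `(col x)₀ = 0`. -/
theorem col_apply_zero (x : Site 4) : col x 0 = 0 := by simp [col]

/-- `(col x)_k = x_k` for `k ≠ 0`. -/
theorem col_apply_of_ne (x : Site 4) {k : Fin 4} (hk : k ≠ 0) : col x k = x k := by simp [col, hk]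

/-- The column of `x + e₀` is the column of `x`. -/
theorem col_add_single_zero (x : Site 4) : col (x + Pi.single 0 1) = col x := by
  funext k
  by_cases hk : k = 0
  · subst hk; simp [col]
  · simp [col, hk]

/-- A bottom-face site is its own column base. -/
theorem col_eq_self {x : Site 4} (hx : x 0 = 0) : col x = x := by
  funext k
  by_cases hk : k = 0
  · subst hk; simp [col, hx]
  · simp [col, hk]

/-- Columns of spatial neighbours are spatial neighbours: `col (x + eᵢ) = col x + eᵢ` (`i ≠ 0`). -/
theorem col_add_single_of_ne (x : Site 4) {i : Fin 4} (hi : i ≠ 0) : col (x + Pi.single i 1) = col x + Pi.single i 1 := by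
  funext k
  by_cases hk : k = 0
  · subst hk; simp [col, Pi.single_eq_of_ne hi.symm]
  · simp [col, hk]

/-! ## §2 The gauge transforms -/

/-- Gauge transformations compose (tree: `QuantumFieldTheory.gaugeTransformZd_gaugeTransformZd`, restated in three lines to keep that import chain out). -/
theorem gaugeTransformZd_mul (g h : Site 4 → SU2) (U : LGConfig 4 SU2) :
    gaugeTransformZd (g * h) U = gaugeTransformZd g (gaugeTransformZd h U) := by
  funext e
  simp only [gaugeTransformZd, Pi.mul_apply, mul_inv_rev, mul_assoc]

/-- Off the interior the spreading gauge is `1`. -/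
theorem spreadGauge_of_not_interior (U : LGConfig 4 SU2) {x : Site 4} (hx : ¬ ∀ k : Fin 4, 1 ≤ x k ∧ x k + 1 ≤ 2 * (H : ℤ)) :
    spreadGauge H U x = 1 := by
  rw [spreadGauge, if_neg hx]

/-- At an interior site the spreading gauge is `kroot (2H) h_y ^ (2H − x₀)`. -/
theorem spreadGauge_of_interior (U : LGConfig 4 SU2) {x : Site 4} (hx : ∀ k : Fin 4, 1 ≤ x k ∧ x k + 1 ≤ 2 * (H : ℤ)) :
    spreadGauge H U x = kroot (2 * H) (forestFix H U (col x, 0)) ^ (2 * H - (x 0).toNat) := by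
  rw [spreadGauge, if_pos hx]

/-- **The uniformising gauge is an interior gauge transform.** -/
theorem uniformGauge_isInteriorGauge (H : ℕ) (U : LGConfig 4 SU2) : IsInteriorGauge H (uniformGauge H U) := by
  intro x hx
  rw [interiorSites_iff] at hx
  show spreadGauge H U x * forestGauge H U x = 1
  rw [spreadGauge_of_not_interior U hx, forestGauge_of_not_interior U hx, one_mul]

/-- The uniformised configuration is the spreading gauge applied to the forest-fixed configuration. -/
theorem gaugeTransformZd_uniformGauge (H : ℕ) (U : LGConfig 4 SU2) :
    gaugeTransformZd (uniformGauge H U) U = gaugeTransformZd (spreadGauge H U) (forestFix H U) :=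
  gaugeTransformZd_mul (spreadGauge H U) (forestGauge H U) U

/-! ## §3 The forest-gauge links in the quaternion length (the tree's abstract Poincaré ladder, `ℓ = ellq`) -/

section Forest

variable {s : ℝ} {U : LGConfig 4 SU2}

/-- The forest-fixed configuration is `1` off the cold box. -/
theorem forestFix_out (hW : ColdWall H U) :
    ∀ e : Literature.MathematicalPhysics.QuantumLattice.ZdEdge 4, e ∉ boxEdges 4 (2 * H + 1) → forestFix H U e = 1 :=
  fun e he => by rw [forestFix_apply_of_not_mem_boxEdges U he]; exact hW e he

/-- The forest-fixed configuration is `1` on the forest. -/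
theorem forestFix_onForest (U : LGConfig 4 SU2) :
    ∀ x : Site 4, (∀ k : Fin 4, 1 ≤ x k ∧ x k + 1 ≤ 2 * (H : ℤ)) → forestFix H U (x, 0) = 1 :=
  fun _ hx => forestFix_forest U hx

/-- Every plaquette holonomy of the forest-fixed configuration has length `≤ s` on `ColdWall ∧ SmallPlaquettes s`. -/
theorem ellq_hol_le (hs : 0 ≤ s) (hW : ColdWall H U) (hS : SmallPlaquettes H s U) (x : Site 4) (i j : Fin 4) :
    ellq (plaquetteHolonomyZd (forestFix H U) x i j) ≤ s := by
  rw [ellq_eq_opDist1]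
  exact ell_hol_le_of_cost_le (forestFix H U) (forestFix_out hW) hs
    (fun p hp => by
      rw [plaqCostAt_forestFix]
      exact hS p.1 (base_bounds_of_mem_plaquettesTouching hp) p.2.1.1 p.2.1.2 (ne_of_lt p.2.2)) x i j

/-- Every forest link: `ℓ ≤ 15·H²·s` (tree `ell_le_uniform`, `12H²+2H+1 ≤ 15H²`). -/
theorem ellq_forestFix_le (hH : 1 ≤ H) (hs : 0 ≤ s) (hW : ColdWall H U) (hS : SmallPlaquettes H s U)
    (e : Literature.MathematicalPhysics.QuantumLattice.ZdEdge 4) : ellq (forestFix H U e) ≤ 15 * (H : ℝ) ^ 2 * s := by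
  have h := ell_le_uniform ellq ellq_one ellq_mul_le ellq_inv (forestFix H U) (forestFix_out hW) (forestFix_onForest U)
    (ellq_hol_le hs hW hS) hH e
  have hH' : (1 : ℝ) ≤ H := by exact_mod_cast hH
  have h2 : (12 * (H : ℝ) ^ 2 + 2 * H + 1) * s ≤ 15 * (H : ℝ) ^ 2 * s :=
    mul_le_mul_of_nonneg_right (by nlinarith) hs
  exact h.trans h2

/-- Spatial forest links inside the slab `0 ≤ x₀ ≤ 2H`: `ℓ ≤ 6·H·s` (tree `ell_spatial`, `ell_spatial_bottom`). -/
theorem ellq_forestFix_spatial_le (hH : 1 ≤ H) (hs : 0 ≤ s) (hW : ColdWall H U) (hS : SmallPlaquettes H s U)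
    {x : Site 4} {i : Fin 4} (hi : i ≠ 0) (h0 : 0 ≤ x 0) (h1 : x 0 ≤ 2 * (H : ℤ)) :
    ellq (forestFix H U (x, i)) ≤ 6 * (H : ℝ) * s := by
  have hH' : (1 : ℝ) ≤ H := by exact_mod_cast hH
  by_cases hx0 : x 0 = 0
  · have h := ell_spatial_bottom ellq (forestFix H U) (forestFix_out hW) (ellq_hol_le hs hW hS) hi hx0
    nlinarith
  · obtain ⟨k, hk⟩ : ∃ k : ℕ, x 0 = 2 * (H : ℤ) - k := ⟨(2 * (H : ℤ) - x 0).toNat, by omega⟩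
    have hk' : (k : ℤ) ≤ 2 * H - 1 := by omega
    have h := ell_spatial ellq ellq_one ellq_mul_le ellq_inv (forestFix H U) (forestFix_out hW) (forestFix_onForest U)
      (ellq_hol_le hs hW hS) k x i hi hk hk'
    have hkr : (k : ℝ) ≤ 2 * H - 1 := by exact_mod_cast hk'
    nlinarith

/-- Temporal forest links in a side face are skin: `ℓ ≤ s` (tree `ell_temporal_face`). -/
theorem ellq_forestFix_temporal_face_le (hs : 0 ≤ s) (hW : ColdWall H U) (hS : SmallPlaquettes H s U)
    {x : Site 4} {j : Fin 4} (hj : j ≠ 0) (hxj : x j = 0 ∨ x j = 2 * (H : ℤ)) : ellq (forestFix H U (x, 0)) ≤ s :=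
  ell_temporal_face ellq ellq_inv (forestFix H U) (forestFix_out hW) (ellq_hol_le hs hW hS) hj hxj

/-- **Neighbouring column holonomies differ by `≤ 8·H·s`**: through the bottom plaquette `(x; e₀, eᵢ)`, `x₀ = 0`, whose other two links are a
bottom-face spatial link (`≤ s`) and a height-one spatial link (`≤ 6Hs`). -/
theorem norm_colHol_sub_le (hH : 1 ≤ H) (hs : 0 ≤ s) (hW : ColdWall H U) (hS : SmallPlaquettes H s U)
    {x : Site 4} (hx0 : x 0 = 0) {i : Fin 4} (hi : i ≠ 0) :
    ‖su2Quat (forestFix H U (x, 0)) - su2Quat (forestFix H U (x + Pi.single i 1, 0))‖ ≤ 8 * (H : ℝ) * s := by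
  have hH' : (1 : ℝ) ≤ H := by exact_mod_cast hH
  set V := forestFix H U with hV
  rw [norm_su2Quat_sub_eq_ellq]
  have hid : V (x, 0) * (V (x + Pi.single i 1, 0))⁻¹ = plaquetteHolonomyZd V x 0 i * V (x, i) *
      (V (x + Pi.single i 1, 0) * (V (x + Pi.single 0 1, i))⁻¹ * (V (x + Pi.single i 1, 0))⁻¹) := by
    rw [hol_eq]; group
  rw [hid]
  have h1 : ellq (plaquetteHolonomyZd V x 0 i) ≤ s := ellq_hol_le hs hW hS x 0 i
  have h2 : ellq (V (x, i)) ≤ s := ell_spatial_bottom ellq V (forestFix_out hW) (ellq_hol_le hs hW hS) hi hx0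
  have h3 : ellq (V (x + Pi.single 0 1, i)) ≤ 6 * (H : ℝ) * s :=
    ellq_forestFix_spatial_le hH hs hW hS hi (by simp [hx0]) (by simp [hx0]; omega)
  calc ellq (plaquetteHolonomyZd V x 0 i * V (x, i) *
        (V (x + Pi.single i 1, 0) * (V (x + Pi.single 0 1, i))⁻¹ * (V (x + Pi.single i 1, 0))⁻¹))
      ≤ ellq (plaquetteHolonomyZd V x 0 i * V (x, i)) +
          ellq (V (x + Pi.single i 1, 0) * (V (x + Pi.single 0 1, i))⁻¹ * (V (x + Pi.single i 1, 0))⁻¹) := ellq_mul_le _ _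
    _ ≤ (ellq (plaquetteHolonomyZd V x 0 i) + ellq (V (x, i))) + ellq (V (x + Pi.single 0 1, i)) := by
        rw [ellq_conj, ellq_inv]; exact add_le_add (ellq_mul_le _ _) le_rfl
    _ ≤ s + s + 6 * (H : ℝ) * s := by linarith
    _ ≤ 8 * (H : ℝ) * s := by nlinarith

end Forest

/-! ## §4 The links of the uniformised configuration -/

/-- **Every temporal link of a spatially interior column equals the root `k_y`** of its column holonomy. -/
theorem temporal_link_eq (hH : 1 ≤ H) (U : LGConfig 4 SU2) {x : Site 4}
    (hsp : ∀ k : Fin 4, k ≠ 0 → 1 ≤ x k ∧ x k + 1 ≤ 2 * (H : ℤ)) (h0 : 0 ≤ x 0) (h1 : x 0 + 1 ≤ 2 * (H : ℤ)) :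
    gaugeTransformZd (spreadGauge H U) (forestFix H U) (x, 0) = kroot (2 * H) (forestFix H U (col x, 0)) := by
  set k := kroot (2 * H) (forestFix H U (col x, 0)) with hk
  have hcol : col (x + Pi.single 0 1) = col x := col_add_single_zero x
  show spreadGauge H U x * forestFix H U (x, 0) * (spreadGauge H U (x + Pi.single 0 1))⁻¹ = k
  by_cases hx0 : x 0 = 0
  · -- the bottom link: `1 · h_y · (k^(2H−1))⁻¹ = k` since `h_y = k^(2H)`
    have hx : ¬ ∀ j : Fin 4, 1 ≤ x j ∧ x j + 1 ≤ 2 * (H : ℤ) := fun h => by have := (h 0).1; omega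
    have hx' : ∀ j : Fin 4, 1 ≤ (x + Pi.single (0 : Fin 4) (1 : ℤ) : Site 4) j ∧ (x + Pi.single (0 : Fin 4) (1 : ℤ) : Site 4) j + 1 ≤ 2 * (H : ℤ) := by
      intro j
      by_cases hj : j = 0
      · subst hj; simp only [Pi.add_apply, Pi.single_eq_same]; omega
      · simp only [Pi.add_apply, Pi.single_eq_of_ne hj, add_zero]; exact hsp j hj
    rw [spreadGauge_of_not_interior U hx, spreadGauge_of_interior U hx', hcol, one_mul]
    have hV : forestFix H U (x, 0) = k ^ (2 * H) := by rw [hk, kroot_pow (by omega), col_eq_self hx0]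
    have hexp : ((x + Pi.single (0 : Fin 4) (1 : ℤ) : Site 4) 0).toNat = 1 := by simp [hx0]
    rw [hV, ← hk, hexp]
    have hpow : k ^ (2 * H) = k * k ^ (2 * H - 1) := by
      rw [← pow_succ']; congr 1; omega
    rw [hpow, mul_inv_cancel_right]
  · -- an interior site: `k^(n+1) · 1 · (k^n)⁻¹ = k`
    have hx : ∀ j : Fin 4, 1 ≤ x j ∧ x j + 1 ≤ 2 * (H : ℤ) := by
      intro j
      by_cases hj : j = 0
      · subst hj; omega
      · exact hsp j hj
    rw [spreadGauge_of_interior U hx, forestFix_forest U hx, mul_one, ← hk]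
    obtain ⟨n, hn⟩ : ∃ n : ℕ, 2 * H - (x 0).toNat = n + 1 := ⟨2 * H - (x 0).toNat - 1, by omega⟩
    have hnext : spreadGauge H U (x + Pi.single 0 1) = k ^ n := by
      by_cases htop : x 0 + 2 ≤ 2 * (H : ℤ)
      · have hx' : ∀ j : Fin 4, 1 ≤ (x + Pi.single (0 : Fin 4) (1 : ℤ) : Site 4) j ∧ (x + Pi.single (0 : Fin 4) (1 : ℤ) : Site 4) j + 1 ≤ 2 * (H : ℤ) := by
          intro j
          by_cases hj : j = 0
          · subst hj; simp only [Pi.add_apply, Pi.single_eq_same]; omega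
          · simp only [Pi.add_apply, Pi.single_eq_of_ne hj, add_zero]; exact hsp j hj
        rw [spreadGauge_of_interior U hx', hcol, ← hk]
        congr 1
        simp only [Pi.add_apply, Pi.single_eq_same]
        omega
      · have hx' : ¬ ∀ j : Fin 4, 1 ≤ (x + Pi.single (0 : Fin 4) (1 : ℤ) : Site 4) j ∧ (x + Pi.single (0 : Fin 4) (1 : ℤ) : Site 4) j + 1 ≤ 2 * (H : ℤ) := by
          intro h
          have := (h 0).2
          simp only [Pi.add_apply, Pi.single_eq_same] at this
          omega
        rw [spreadGauge_of_not_interior U hx']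
        have hn0 : n = 0 := by omega
        rw [hn0, pow_zero]
    rw [hnext, hn, pow_succ', mul_inv_cancel_right]

end Summit.QuantumFields.YangMills.Theorems.AllWindowsColdBoxBoxHighLine.UniformGauge

end
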